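import Mathlib.NumberTheory.Bertrand
import Mathlib.Analysis.SpecialFunctions.Pow.Real
import Mathlib.Analysis.SpecialFunctions.Sqrt
import Literature.Computability.AlgebraicComplexity.LaserHashing
import Literature.Combinatorics.Additive.SliceRankMethod
import HarnessLib

/-!
# Tri-colored sum-free sets from a tight type class by hashing (Kleinberg–Sawin–Speyer 2018, §4)

Topic `Literature/Combinatorics/Additive`. The combinatorial half of the proof of
Kleinberg–Sawin–Speyer 2018, Theorem 2 / Theorem 13 (`TricoloredSumFreeLowerBound.lean`,
named fact `KleinbergSawinSpeyer2018_thm2`): from the type class `W ⊆ Iⁿ`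
(`I = {0,…,q-1}`, all words with a fixed histogram whose mean is `(q-1)/3`) and the tight set
`V = {(a,b,c) ∈ W³ : a + b + c = t}`, `t = (q-1,…,q-1)`, assumed nonempty, a tri-colored
sum-free set in `C_qⁿ` of size `≥ |W| · e^{-2√(2 log 2 · log(6q|W|))} / O_q(√log |W|)`.

## The printed argument (held text `paper:arxiv-1607.00047`, pp. 7–9) and what replaces it

KSS choose a prime `p` between `4|V|/|W|` and `8|V|/|W|` (Bertrand), a progression-free
`S ⊆ 𝔽_p` (Behrend), a random linear hash, and keep the triples of `V` whose three hash values
coincide and lie in `S` and which collide with no other such triple (Lemmas 9–12); the expected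
number is `≥ (1/32) e^{-2√(2 log 2 log p)} |W|` (Lemma 12), and Lemma 8/9 show that the kept set is
sum-free in `C_qⁿ` (not only in `ℤⁿ`) because every word of `W` has digit sum `n(q-1)/3`.
This random-hashing step IS the Coppersmith–Winograd / Bürgisser–Clausen–Shokrollahi hashing
theorem, already PROVED in the tree in exactly the needed deterministic form
(`Literature.Computability.AlgebraicComplexity.BCS1997_thm1539_free`: a `b`-tight set `Φ` with
fibres `≤ f` contains a *free diagonal* `Δ` with `M³|Δ| ≥ |Φ|·|D|·(M − 3f)`, `D` the
Salem–Spencer diagonal of a progression-free set, `exists_zeroSum_diagonal`). So here: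

* `exists_perm_comp_eq`, `card_filter_comp_perm` — words with the same histogram differ by a
  permutation of the coordinates (KSS, proof of Lemma 12: "`S_n` acts on `V` and `W` … this
  action on `W` is transitive"), whence all fibres of `V → W` have the same size `f = |V|/|W|`;
* `exists_tricoloredSumFree_of_typeClass` — **KSS §4 (Lemmas 8, 9, 12, Thm. 13, combinatorial
  part)**: with `M` a prime in `(6fq, 12fq]` and the Salem–Spencer diagonal of a progression-free
  subset of `{0,…,⌊M/2⌋-1}`, the free diagonal `Δ ⊆ V` of the hashing theorem has
  `|Δ| ≥ |W|·|D|/(24qM)`; indexing `Δ` and reducing mod `q` (third word shifted by `1`) gives a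
  tri-colored sum-free family in `(Fin n → ZMod q)` — freeness in `ℤⁿ` upgrades to `C_qⁿ` by the
  digit-sum argument of KSS Lemma 9. The Behrend-type lower bound for `rothNumberNat` enters as a
  hypothesis (discharged by `Literature.Combinatorics.Additive.roth_lower_bound_sharp'`,
  `BehrendSharp.lean`), giving `|Δ| ≥ c|W| e^{-2√(2 log 2 log(6q|W|))}/(72 q √log(6q|W|))`.

The analytic half (choice of the histogram from the Norin–Pebody distribution, `|W| = θⁿ e^{-O(log n)}`)
is not in this file.

## References

* [KleinbergSawinSpeyer2018] R. Kleinberg, W. Sawin, D. E. Speyer, *The growth rate of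
  tri-colored sum-free sets*, Discrete Analysis 2018:12 — §4, Lemmas 8–12, Thm. 13 (pp. 7–9).
* [BurgisserClausenShokrollahi1997] P. Bürgisser, M. Clausen, M. A. Shokrollahi, *Algebraic
  Complexity Theory*, Thm. 15.39 (the hashing theorem; tree: `LaserHashing.lean`).
-/

noncomputable section

open Finset Real

namespace Literature.Combinatorics.Additive

open Literature.Computability.AlgebraicComplexity (BCS1997_thm1539_free exists_zeroSum_diagonal)

namespace KSS

/-- Histograms are invariant under permuting the coordinates. [folklore] -/
theorem card_filter_comp_perm {α β : Type*} [Fintype α] [DecidableEq β] (x : α → β)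
    (σ : Equiv.Perm α) (i : β) :
    (univ.filter fun r => x (σ r) = i).card = (univ.filter fun r => x r = i).card := by
  refine Finset.card_bij (fun r _ => σ r) (fun r hr => ?_) (fun r₁ _ r₂ _ h => σ.injective h)
    (fun r hr => ⟨σ.symm r, ?_, by simp⟩)
  · simpa using hr
  · simpa using hr

/-- **Words with the same histogram differ by a permutation of the coordinates** (KSS 2018, proof
of Lemma 12: the action of `S_n` on a type class is transitive). [cite: KleinbergSawinSpeyer2018, Lemma 12 (proof)] -/
theorem exists_perm_comp_eq {α β : Type*} [Fintype α] [DecidableEq α] [DecidableEq β]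
    {a a' : α → β}
    (h : ∀ i, (univ.filter fun r => a r = i).card = (univ.filter fun r => a' r = i).card) :
    ∃ σ : Equiv.Perm α, ∀ r, a (σ r) = a' r := by
  have hc : ∀ c, Fintype.card {r // a' r = c} = Fintype.card {r // a r = c} := by
    intro c; rw [Fintype.card_subtype, Fintype.card_subtype, h c]
  exact ⟨Equiv.ofFiberEquiv (f := a') (g := a) (fun c => Fintype.equivOfCardEq (hc c)),
    fun r => Equiv.ofFiberEquiv_map _ r⟩

/-- The digit sum of a word is determined by its histogram: `∑_r a(r) = ∑_i i · #{r : a(r) = i}`.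
[folklore] -/
theorem sum_val_eq_sum_mul_card {N q : ℕ} (a : Fin N → Fin q) :
    ∑ r, (a r : ℕ) = ∑ i : Fin q, (i : ℕ) * (univ.filter fun r => a r = i).card := by
  classical
  rw [← Finset.sum_fiberwise_of_maps_to (g := a) (t := (univ : Finset (Fin q)))
    (fun r _ => mem_univ (a r))]
  refine Finset.sum_congr rfl fun i _ => ?_
  rw [Finset.sum_congr rfl (g := fun _ => (i : ℕ)) (fun r hr => by rw [(mem_filter.1 hr).2]),
    sum_const, smul_eq_mul, mul_comm]

/-- The arithmetic of KSS 2018, proof of Thm. 13 / Lemma 12: from `M³ s ≥ |W| f |D| (M - 3f)`,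
`|D| ≥ c K e^{-2√(2 log 2 log K)}/√log K` (`K = ⌊M/2⌋`), `6fq < M ≤ 12fq`, `1 ≤ f ≤ |W|`, conclude
`s ≥ c |W| e^{-2√(2 log 2 log(6q|W|))} / (72 q √log(6q|W|))`. [cite: KleinbergSawinSpeyer2018, Lemma 12 (proof)] -/
theorem size_bound_aux {cB : ℝ} {Wc f M K Dc s q : ℕ} (hcB : 0 < cB) (hq : 2 ≤ q) (hf1 : 1 ≤ f)
    (hfW : f ≤ Wc) (hXM : 6 * f * q < M) (hM2X : M ≤ 2 * (6 * f * q)) (hKM : 2 * K ≤ M)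
    (hMK : M ≤ 2 * K + 1) (hK2 : 2 ≤ K)
    (hs : ((Wc : ℝ) * f) * Dc * ((M : ℝ) - 3 * f) ≤ (M : ℝ) ^ 3 * s)
    (hB : cB * K * exp (-2 * √(2 * Real.log 2 * Real.log K)) / √(Real.log K) ≤ Dc) :
    cB * Wc * exp (-2 * √(2 * Real.log 2 * Real.log (6 * q * Wc))) /
        (72 * q * √(Real.log (6 * q * Wc))) ≤ s := by
  have hKr : (2 : ℝ) ≤ K := by exact_mod_cast hK2
  have hKMr : 2 * (K : ℝ) ≤ M := by exact_mod_cast hKM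
  have hMKr : (M : ℝ) ≤ 2 * K + 1 := by exact_mod_cast hMK
  have hfr : (1 : ℝ) ≤ f := by exact_mod_cast hf1
  have hfWr : (f : ℝ) ≤ Wc := by exact_mod_cast hfW
  have hXMr : 6 * (f : ℝ) * q < M := by exact_mod_cast hXM
  have hM2Xr : (M : ℝ) ≤ 2 * (6 * f * q) := by exact_mod_cast hM2X
  have hqr : (2 : ℝ) ≤ q := by exact_mod_cast hq
  have hMpos : (0 : ℝ) < M := by linarith
  have hKpos : (0 : ℝ) < K := by linarith
  have hDc : (0 : ℝ) ≤ Dc := Nat.cast_nonneg _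
  have hWpos : (0 : ℝ) ≤ Wc := Nat.cast_nonneg _
  have hs0 : (0 : ℝ) ≤ s := Nat.cast_nonneg _
  have hq0 : (0 : ℝ) ≤ q := by linarith
  -- Behrend at `K`, transported to the argument `Y = 6 q Wc ≥ K`
  set Y : ℝ := 6 * (q : ℝ) * Wc with hY
  have hKY : (K : ℝ) ≤ Y := by rw [hY]; nlinarith
  have hlogK : 0 < Real.log K := Real.log_pos (by linarith)
  have hlogKY : Real.log K ≤ Real.log Y := Real.log_le_log hKpos hKY
  have hsqK : 0 < √(Real.log K) := Real.sqrt_pos.2 hlogK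
  have hsqKY : √(Real.log K) ≤ √(Real.log Y) := Real.sqrt_le_sqrt hlogKY
  have hsqY : 0 < √(Real.log Y) := lt_of_lt_of_le hsqK hsqKY
  have hlog2 : 0 ≤ 2 * Real.log 2 := by
    have := Real.log_pos (by norm_num : (1 : ℝ) < 2); linarith
  set E : ℝ := exp (-2 * √(2 * Real.log 2 * Real.log Y)) with hE
  have hEpos : 0 < E := Real.exp_pos _
  have hexpKY : E ≤ exp (-2 * √(2 * Real.log 2 * Real.log K)) := by
    apply Real.exp_le_exp.2
    have : √(2 * Real.log 2 * Real.log K) ≤ √(2 * Real.log 2 * Real.log Y) :=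
      Real.sqrt_le_sqrt (mul_le_mul_of_nonneg_left hlogKY hlog2)
    linarith
  have hcBK : 0 ≤ cB * K := by positivity
  have hBY : cB * K * E / √(Real.log Y) ≤ Dc := by
    refine le_trans ?_ hB
    calc cB * K * E / √(Real.log Y)
        ≤ cB * K * exp (-2 * √(2 * Real.log 2 * Real.log K)) / √(Real.log Y) :=
          div_le_div_of_nonneg_right (mul_le_mul_of_nonneg_left hexpKY hcBK) hsqY.le
      _ ≤ cB * K * exp (-2 * √(2 * Real.log 2 * Real.log K)) / √(Real.log K) :=
          div_le_div_of_nonneg_left (by positivity) hsqK hsqKY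
  -- elementary inequalities: `f (M - 3f) ≥ M² / (24 q)` and `M ≤ 3K`
  have hf0 : (0 : ℝ) ≤ f := by linarith
  have h6f : 6 * (f : ℝ) ≤ M := by nlinarith [mul_nonneg (sub_nonneg.2 hqr) hf0]
  have hA : (f : ℝ) * ((M : ℝ) / 2) ≤ f * ((M : ℝ) - 3 * f) :=
    mul_le_mul_of_nonneg_left (by linarith) hf0
  have hB2 : (M : ℝ) ^ 2 ≤ 24 * q * ((f : ℝ) * ((M : ℝ) / 2)) := by
    have := mul_le_mul_of_nonneg_left hM2Xr hMpos.le
    nlinarith [this]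
  have hfM : (M : ℝ) ^ 2 ≤ 24 * q * ((f : ℝ) * ((M : ℝ) - 3 * f)) :=
    hB2.trans (mul_le_mul_of_nonneg_left hA (by positivity))
  have hM3K : (M : ℝ) ≤ 3 * K := by linarith
  -- conclude
  have hWDc : 0 ≤ (Wc : ℝ) * Dc := mul_nonneg hWpos hDc
  have step1 : (Wc : ℝ) * Dc * (M : ℝ) ^ 2 ≤ 24 * q * ((M : ℝ) ^ 3 * s) := by
    calc (Wc : ℝ) * Dc * (M : ℝ) ^ 2
        ≤ (Wc : ℝ) * Dc * (24 * q * ((f : ℝ) * ((M : ℝ) - 3 * f))) :=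
          mul_le_mul_of_nonneg_left hfM hWDc
      _ = 24 * q * (((Wc : ℝ) * f) * Dc * ((M : ℝ) - 3 * f)) := by ring
      _ ≤ 24 * q * ((M : ℝ) ^ 3 * s) := mul_le_mul_of_nonneg_left hs (by positivity)
  have step2 : (Wc : ℝ) * Dc ≤ 24 * q * M * s := by
    have hM2 : (0 : ℝ) < (M : ℝ) ^ 2 := by positivity
    have : (Wc : ℝ) * Dc * (M : ℝ) ^ 2 ≤ (24 * q * M * s) * (M : ℝ) ^ 2 := by
      calc (Wc : ℝ) * Dc * (M : ℝ) ^ 2 ≤ 24 * q * ((M : ℝ) ^ 3 * s) := step1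
        _ = (24 * q * M * s) * (M : ℝ) ^ 2 := by ring
    exact le_of_mul_le_mul_right this hM2
  have t1 : cB * Wc * E * K / √(Real.log Y) ≤ 24 * q * M * s := by
    have h := mul_le_mul_of_nonneg_left hBY hWpos
    have e1 : (Wc : ℝ) * (cB * K * E / √(Real.log Y)) = cB * Wc * E * K / √(Real.log Y) := by
      ring
    rw [e1] at h
    exact h.trans step2
  have t2 : cB * Wc * E * K ≤ 24 * q * M * s * √(Real.log Y) := (div_le_iff₀ hsqY).1 t1
  have t3 : 24 * q * M * s * √(Real.log Y) ≤ (72 * q * s * √(Real.log Y)) * K := by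
    have hc : 0 ≤ 24 * ((q : ℝ) * s * √(Real.log Y)) := by positivity
    calc 24 * q * M * s * √(Real.log Y) = (24 * ((q : ℝ) * s * √(Real.log Y))) * M := by ring
      _ ≤ (24 * ((q : ℝ) * s * √(Real.log Y))) * (3 * K) := mul_le_mul_of_nonneg_left hM3K hc
      _ = (72 * q * s * √(Real.log Y)) * K := by ring
  have t4 : cB * Wc * E ≤ 72 * q * s * √(Real.log Y) :=
    le_of_mul_le_mul_right (t2.trans t3) hKpos
  rw [div_le_iff₀ (by positivity)]
  linarith [t4]

/-- **Kleinberg–Sawin–Speyer 2018, §4 (Lemmas 8, 9, 12 and Theorem 13, combinatorial part)**.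
Let `W` be the set of words `a ∈ {0,…,q-1}ᴺ` with a fixed histogram `k` of mean `(q-1)/3`
(`3 ∑ i kᵢ = (q-1)N`), and assume the tight set `V = {(a,b,c) ∈ W³ : a + b + c ≡ q-1}` (sums in
`ℕ`, coordinatewise) is nonempty. Given Behrend's bound in the form
`c·M·e^{-2√(2 log 2 log M)}/√(log M) ≤ r₃(M)` (`M ≥ 2`), there is a tri-colored sum-free family
in `C_qᴺ = (Fin N → ZMod q)` of size
`≥ c·|W|·e^{-2√(2 log 2 · log(6q|W|))} / (72 q √(log(6q|W|)))`.
Proof: all fibres of `V → W` have the same size `f` (transitivity of `S_N` on `W`); the hashing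
theorem `BCS1997_thm1539_free` with a prime `M ∈ (6fq, 12fq]` (Bertrand) and the Salem–Spencer
diagonal of a progression-free subset of `{0,…,⌊M/2⌋-1}` gives a free diagonal `Δ ⊆ V`,
`M³|Δ| ≥ |V||D|(M-3f)`; reduce `Δ` mod `q` (KSS Lemma 9: a relation `aᵢ + bⱼ + c_k = t` in `C_qᴺ`
lifts to `ℤᴺ` because all digit sums are `N(q-1)/3`, Lemma 8).
[cite: KleinbergSawinSpeyer2018, Thm. 13 (proof), Lemmas 8, 9, 12] -/
theorem exists_tricoloredSumFree_of_typeClass {q N : ℕ} (hq : 2 ≤ q) (k : Fin q → ℕ)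
    (W : Finset (Fin N → Fin q))
    (hW : ∀ a, a ∈ W ↔ ∀ i, (univ.filter fun r => a r = i).card = k i)
    (hmean : 3 * ∑ i : Fin q, (i : ℕ) * k i = (q - 1) * N)
    (hV : ∃ a ∈ W, ∃ b ∈ W, ∃ c ∈ W, ∀ r, (a r : ℕ) + b r + c r = q - 1)
    {cB : ℝ} (hcB : 0 < cB)
    (hBeh : ∀ M : ℕ, 2 ≤ M →
      cB * M * exp (-2 * √(2 * Real.log 2 * Real.log M)) / √(Real.log M) ≤ rothNumberNat M) :
    ∃ (s : ℕ) (x y z : Fin s → (Fin N → ZMod q)), IsTricoloredSumFree x y z ∧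
      cB * W.card * exp (-2 * √(2 * Real.log 2 * Real.log (6 * q * W.card))) /
        (72 * q * √(Real.log (6 * q * W.card))) ≤ s := by
  classical
  -- the tight set `V`
  set V : Finset ((Fin N → Fin q) × (Fin N → Fin q) × (Fin N → Fin q)) :=
    (W ×ˢ W ×ˢ W).filter (fun t => ∀ r, (t.1 r : ℕ) + t.2.1 r + t.2.2 r = q - 1) with hVdef
  have hmemV : ∀ t, t ∈ V ↔
      (t.1 ∈ W ∧ t.2.1 ∈ W ∧ t.2.2 ∈ W) ∧ ∀ r, (t.1 r : ℕ) + t.2.1 r + t.2.2 r = q - 1 := by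
    intro t; simp only [hVdef, mem_filter, mem_product]
  -- words of `W` have digit sum `T` with `3T = (q-1)N`
  have hdigits : ∀ a ∈ W, ∑ r, (a r : ℕ) = ∑ i : Fin q, (i : ℕ) * k i := by
    intro a ha
    rw [sum_val_eq_sum_mul_card]
    exact Finset.sum_congr rfl fun i _ => by rw [(hW a).1 ha i]
  -- permutations of the coordinates preserve `W`
  have hWperm : ∀ (σ : Equiv.Perm (Fin N)), ∀ x ∈ W, (fun r => x (σ r)) ∈ W := fun σ x hx =>
    (hW _).2 fun i => by rw [card_filter_comp_perm, (hW x).1 hx i]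
  -- Step 1: all fibres of the first projection over `W` have the same size
  have hfib_le : ∀ a ∈ W, ∀ a' ∈ W,
      (V.filter fun t => t.1 = a).card ≤ (V.filter fun t => t.1 = a').card := by
    intro a ha a' ha'
    obtain ⟨σ, hσ⟩ : ∃ σ : Equiv.Perm (Fin N), ∀ r, a (σ r) = a' r :=
      exists_perm_comp_eq (fun i => by rw [(hW a).1 ha i, (hW a').1 ha' i])
    refine Finset.card_le_card_of_injOn
      (fun t => ((fun r => t.1 (σ r)), (fun r => t.2.1 (σ r)), (fun r => t.2.2 (σ r)))) ?_ ?_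
    · intro t ht
      rw [Finset.mem_coe, mem_filter] at ht ⊢
      obtain ⟨htV, hta⟩ := ht
      obtain ⟨⟨h1, h2, h3⟩, hsum⟩ := (hmemV t).1 htV
      refine ⟨(hmemV _).2 ⟨⟨hWperm σ _ h1, hWperm σ _ h2, hWperm σ _ h3⟩, fun r => hsum (σ r)⟩,
        ?_⟩
      funext r
      show t.1 (σ r) = a' r
      rw [hta]; exact hσ r
    · intro t _ t' _ h
      simp only [Prod.mk.injEq] at h
      have hinj : ∀ {x x' : Fin N → Fin q}, (fun r => x (σ r)) = (fun r => x' (σ r)) → x = x' :=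
        fun {x x'} h => by
          funext r
          have := congrFun h (σ.symm r)
          simpa using this
      exact Prod.ext (hinj h.1) (Prod.ext (hinj h.2.1) (hinj h.2.2))
  have hfib_eq : ∀ a ∈ W, ∀ a' ∈ W,
      (V.filter fun t => t.1 = a).card = (V.filter fun t => t.1 = a').card :=
    fun a ha a' ha' => le_antisymm (hfib_le a ha a' ha') (hfib_le a' ha' a ha)
  obtain ⟨a₀, ha₀, b₀, hb₀, c₀, hc₀, hsum₀⟩ := hV
  have ht₀ : (a₀, b₀, c₀) ∈ V := (hmemV _).2 ⟨⟨ha₀, hb₀, hc₀⟩, hsum₀⟩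
  set f := (V.filter fun t => t.1 = a₀).card with hfdef
  have hfI : ∀ a, (V.filter fun t => t.1 = a).card ≤ f := by
    intro a
    by_cases ha : a ∈ W
    · exact (hfib_eq a ha a₀ ha₀).le
    · rw [Finset.card_eq_zero.2]
      · exact Nat.zero_le _
      · rw [Finset.filter_eq_empty_iff]
        intro t ht hta
        exact ha (hta ▸ ((hmemV t).1 ht).1.1)
  -- the second and third projections, by the symmetries of `V`
  have hswap12 : ∀ b, (V.filter fun t => t.2.1 = b).card = (V.filter fun t => t.1 = b).card := by
    intro b
    refine Finset.card_bij (fun t _ => (t.2.1, t.1, t.2.2)) ?_ ?_ ?_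
    · intro t ht
      rw [mem_filter] at ht ⊢
      obtain ⟨htV, htb⟩ := ht
      obtain ⟨⟨h1, h2, h3⟩, hsum⟩ := (hmemV t).1 htV
      exact ⟨(hmemV _).2 ⟨⟨h2, h1, h3⟩, fun r => by have := hsum r; dsimp only; omega⟩, htb⟩
    · intro t _ t' _ h
      simp only [Prod.mk.injEq] at h
      exact Prod.ext h.2.1 (Prod.ext h.1 h.2.2)
    · intro t ht
      rw [mem_filter] at ht
      obtain ⟨htV, htb⟩ := ht
      obtain ⟨⟨h1, h2, h3⟩, hsum⟩ := (hmemV t).1 htV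
      refine ⟨(t.2.1, t.1, t.2.2), ?_, rfl⟩
      rw [mem_filter]
      exact ⟨(hmemV _).2 ⟨⟨h2, h1, h3⟩, fun r => by have := hsum r; dsimp only; omega⟩, htb⟩
  have hswap13 : ∀ c, (V.filter fun t => t.2.2 = c).card = (V.filter fun t => t.1 = c).card := by
    intro c
    refine Finset.card_bij (fun t _ => (t.2.2, t.2.1, t.1)) ?_ ?_ ?_
    · intro t ht
      rw [mem_filter] at ht ⊢
      obtain ⟨htV, htc⟩ := ht
      obtain ⟨⟨h1, h2, h3⟩, hsum⟩ := (hmemV t).1 htV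
      exact ⟨(hmemV _).2 ⟨⟨h3, h2, h1⟩, fun r => by have := hsum r; dsimp only; omega⟩, htc⟩
    · intro t _ t' _ h
      simp only [Prod.mk.injEq] at h
      exact Prod.ext h.2.2 (Prod.ext h.2.1 h.1)
    · intro t ht
      rw [mem_filter] at ht
      obtain ⟨htV, htc⟩ := ht
      obtain ⟨⟨h1, h2, h3⟩, hsum⟩ := (hmemV t).1 htV
      refine ⟨(t.2.2, t.2.1, t.1), ?_, rfl⟩
      rw [mem_filter]
      exact ⟨(hmemV _).2 ⟨⟨h3, h2, h1⟩, fun r => by have := hsum r; dsimp only; omega⟩, htc⟩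
  have hfJ : ∀ b, (V.filter fun t => t.2.1 = b).card ≤ f := fun b => (hswap12 b).trans_le (hfI b)
  have hfL : ∀ c, (V.filter fun t => t.2.2 = c).card ≤ f := fun c => (hswap13 c).trans_le (hfI c)
  -- `|V| = |W| f`, `1 ≤ f ≤ |W|`
  have hVcard : V.card = W.card * f := by
    rw [Finset.card_eq_sum_card_fiberwise (f := fun t => t.1) (s := V) (t := W)
      (fun t ht => ((hmemV t).1 ht).1.1)]
    exact Finset.sum_const_nat fun a ha => hfib_eq a ha a₀ ha₀
  have hf1 : 1 ≤ f := Finset.card_pos.2 ⟨(a₀, b₀, c₀), mem_filter.2 ⟨ht₀, rfl⟩⟩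
  have hfW : f ≤ W.card := by
    refine Finset.card_le_card_of_injOn (fun t => t.2.1) (fun t ht => ?_) ?_
    · rw [Finset.mem_coe, mem_filter] at ht
      exact ((hmemV t).1 ht.1).1.2.1
    · intro t ht t' ht' h
      rw [Finset.mem_coe, mem_filter] at ht ht'
      have e1 : t.1 = t'.1 := ht.2.trans ht'.2.symm
      have hs := ((hmemV t).1 ht.1).2
      have hs' := ((hmemV t').1 ht'.1).2
      refine Prod.ext e1 (Prod.ext h ?_)
      funext r
      apply Fin.ext
      have h1 := hs r; have h2 := hs' r
      have e1r : (t.1 r : ℕ) = t'.1 r := by rw [e1]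
      have e2r : (t.2.1 r : ℕ) = t'.2.1 r := by rw [show t.2.1 = t'.2.1 from h]
      omega
  -- Step 2: the modulus `M` and the Salem–Spencer diagonal
  have hq1 : 1 ≤ q := by omega
  obtain ⟨M, hMp, hXM, hM2X⟩ := Nat.exists_prime_lt_and_le_two_mul (6 * f * q) (by positivity)
  haveI : NeZero M := ⟨hMp.ne_zero⟩
  obtain ⟨D₁, D₂, D₃, hD₁, hD₂, hD₃, hDcard⟩ := exists_zeroSum_diagonal M (M / 2) (by omega)
  -- Step 3: the hashing theorem
  have h2b : 2 * (q - 1) < M := by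
    have : 6 * q ≤ 6 * f * q := by nlinarith
    omega
  have hinj : Function.Injective fun (x : Fin N → Fin q) (ρ : Fin N) => ((x ρ : ℕ) : ℤ) := by
    intro x x' h
    funext ρ
    have h1 : ((x ρ : ℕ) : ℤ) = ((x' ρ : ℕ) : ℤ) := congrFun h ρ
    exact Fin.ext (by exact_mod_cast h1)
  have hinj' : Function.Injective
      fun (z : Fin N → Fin q) (ρ : Fin N) => ((z ρ : ℕ) : ℤ) - ((q - 1 : ℕ) : ℤ) := by
    intro z z' h
    funext ρ
    have h1 : ((z ρ : ℕ) : ℤ) - ((q - 1 : ℕ) : ℤ) = ((z' ρ : ℕ) : ℤ) - ((q - 1 : ℕ) : ℤ) :=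
      congrFun h ρ
    have h2 : ((z ρ : ℕ) : ℤ) = ((z' ρ : ℕ) : ℤ) := by linarith
    exact Fin.ext (by exact_mod_cast h2)
  have hbound : ∀ (x : Fin N → Fin q) (ρ : Fin N), |((x ρ : ℕ) : ℤ)| ≤ ((q - 1 : ℕ) : ℤ) := by
    intro x ρ
    rw [abs_of_nonneg (by positivity)]
    have := (x ρ).isLt
    have : (x ρ : ℕ) ≤ q - 1 := by omega
    exact_mod_cast this
  obtain ⟨Δ, hΔV, hfree, hsize⟩ := BCS1997_thm1539_free V (r := N) (b := q - 1)
    (fun x ρ => ((x ρ : ℕ) : ℤ)) (fun y ρ => ((y ρ : ℕ) : ℤ))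
    (fun z ρ => ((z ρ : ℕ) : ℤ) - ((q - 1 : ℕ) : ℤ)) hinj hinj hinj' hbound hbound
    (fun φ hφ ρ => by
      have h := ((hmemV φ).1 hφ).2 ρ
      have h' : (((φ.1 ρ : ℕ) + φ.2.1 ρ + φ.2.2 ρ : ℕ) : ℤ) = ((q - 1 : ℕ) : ℤ) := by rw [h]
      push_cast at h' ⊢
      linarith)
    hfI hfJ hfL hMp h2b D₁ D₂ D₃ hD₁ hD₂ hD₃
  -- Step 4: the tri-colored sum-free family indexed by `Δ`
  set s := Δ.card with hsdef
  let e : Fin s ≃ {t // t ∈ Δ} := Δ.equivFin.symm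
  refine ⟨s, fun i r => (((e i).1.1 r : ℕ) : ZMod q), fun i r => (((e i).1.2.1 r : ℕ) : ZMod q),
    fun i r => (((e i).1.2.2 r : ℕ) : ZMod q) + 1, ?_, ?_⟩
  · intro i j l
    constructor
    · intro hzero
      -- the three words
      have hi := hΔV (e i).2
      have hj := hΔV (e j).2
      have hl := hΔV (e l).2
      set a := (e i).1.1 with ha
      set b := (e j).1.2.1 with hb
      set c := (e l).1.2.2 with hc
      have haW : a ∈ W := ((hmemV _).1 hi).1.1
      have hbW : b ∈ W := ((hmemV _).1 hj).1.2.1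
      have hcW : c ∈ W := ((hmemV _).1 hl).1.2.2
      -- coordinatewise: `q ∣ a r + b r + c r + 1`, hence `a r + b r + c r ≥ q - 1`
      have hge : ∀ r, q - 1 ≤ (a r : ℕ) + b r + c r := by
        intro r
        have hr := congrFun hzero r
        simp only [Pi.add_apply, Pi.zero_apply] at hr
        have hcast : (((a r : ℕ) + b r + c r + 1 : ℕ) : ZMod q) = 0 := by
          push_cast; rw [← hr]; ring
        have hdvd := (ZMod.natCast_eq_zero_iff _ _).1 hcast
        have := Nat.le_of_dvd (Nat.succ_pos _) hdvd
        omega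
      -- digit sums: `∑_r (a r + b r + c r) = N (q - 1)`
      have hsumall : ∑ r, ((a r : ℕ) + b r + c r) = ∑ _r : Fin N, (q - 1) := by
        rw [sum_add_distrib, sum_add_distrib, hdigits a haW, hdigits b hbW, hdigits c hcW,
          sum_const, card_univ, Fintype.card_fin, smul_eq_mul, Nat.mul_comm N]
        omega
      have hall : ∀ r ∈ (univ : Finset (Fin N)), (a r : ℕ) + b r + c r = q - 1 := by
        have := (Finset.sum_eq_sum_iff_of_le (fun r _ => hge r)).1 hsumall.symm
        intro r hr; exact (this r hr).symm
      have habcV : (a, b, c) ∈ V := (hmemV _).2 ⟨⟨haW, hbW, hcW⟩, fun r => hall r (mem_univ r)⟩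
      have hfr := hfree _ (e i).2 _ (e j).2 _ (e l).2 habcV
      refine ⟨e.injective (Subtype.ext hfr.1), e.injective (Subtype.ext hfr.2)⟩
    · rintro ⟨rfl, rfl⟩
      funext r
      have hi := hΔV (e i).2
      have hsum := ((hmemV _).1 hi).2 r
      simp only [Pi.add_apply, Pi.zero_apply]
      have hcast : ((((e i).1.1 r : ℕ) + (e i).1.2.1 r + (e i).1.2.2 r + 1 : ℕ) : ZMod q) = 0 := by
        rw [hsum, Nat.sub_add_cancel hq1, ZMod.natCast_self]
      push_cast at hcast
      rw [← hcast]; ring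
  · -- Step 5: the size bound
    have hM13 : 13 ≤ M := by
      have : 6 * 1 * 2 ≤ 6 * f * q := Nat.mul_le_mul (Nat.mul_le_mul_left 6 hf1) hq
      omega
    have hVc : ((W.card : ℝ) * f) *
        ((((D₁ ×ˢ D₂ ×ˢ D₃).filter fun d => d.1 + d.2.1 + d.2.2 = 0).card : ℕ) : ℝ) *
        ((M : ℝ) - 3 * f) ≤ (M : ℝ) ^ 3 * s := by
      have h := hsize
      rw [hVcard] at h
      have h' := (Int.cast_le (R := ℝ)).2 h
      push_cast at h'
      linarith
    refine size_bound_aux (K := M / 2) hcB hq hf1 hfW hXM hM2X (Nat.mul_div_le M 2) (by omega)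
      (by omega) hVc ((hBeh (M / 2) (by omega)).trans (by exact_mod_cast hDcard))

end KSS

end Literature.Combinatorics.Additive
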